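import Summits.Ventures.HSemireg.Mod4SignLawParity
import Summits.Ventures.HSemireg.FormulaNStatement
import Literature.AlgebraicGeometry.Motives.HodgeStructureExteriorPowerLefschetzDual

/-!
# Venture HSemireg — (S3): the PAIRING STEP of FORMULA-N §D in the exterior model (`e^{-B}·e^{B̄} = e^{-2s·b}`, top term) and the Lemma-profile Euler characteristic (second proof route, part 3)

HONEST FRAMING. Part of the Lean index of the computation cell `pub-hsemireg` (TRACK «S4-PUSH» (ii), seat s4-prove-3,
SECOND proof route; work log `s4push/prove-3/ATTEMPT-1.md`).  FINITE-DIMENSIONAL EXTERIOR ALGEBRA over a field of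
characteristic 0 ONLY (Mathlib's nilpotent exponential `IsNilpotent.exp`; the `ℚ`-module structure on `M` by restriction
of scalars enters as the instances `[Module ℚ M] [IsScalarTower ℚ K M]`, automatic for coordinate modules): no abelian variety, no sheaf, no Ext group, no semiregularity map and no HRR is constructed or
proved here; nothing here says that HC, HC_CM or HC_AV holds; no Literature fact is declared or used.

WHAT IT INDEXES.  FORMULA-N-th7 §D computes, for a `K`-secant plane `P ⊗ ℂ = ⟨ℓ, ℓ̄⟩`, `ℓ = c·e^B`, `B = a + √-d·b`:
`(ℓ,ℓ)_χ = 0`, `(ℓ,ℓ̄)_χ = |c|²∫e^{-B}e^{B̄} = |c|²∫e^{B̄-B} = |c|²(-2√-d)ⁿ∫bⁿ/n!`, whence `(v,v)_χ = 2|x|²|c|²(-4d)^{n/2}∫bⁿ/n!` at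
even `n` (part 2's `chiSelfEven`, there BY VALUE).  This file makes the EXTERIOR-ALGEBRA part of that computation a kernel statement
in the frame-free model of parts 1–2 (`b(λ) = Σ λ_a dx_a∧dy_a`, `vol = Π dx_a∧dy_a`):
* `diagForm_pow_succ` / `isNilpotent_diagForm` — `b(λ)^{n+1} = 0`;
* `exp_smul_diagForm` — **`exp(t·b(λ)) = Σ_{k<n} (tᵏ/k!)·b(λ)ᵏ + (tⁿ·∏_a λ_a)·vol`** (the top term is exact, by part 1's
  `b(λ)ⁿ = n!·∏λ_a·vol`);
* `exp_neg_mul_exp_conj` — for `B = A + s·b(λ)`, `B̄ = A - s·b(λ)` with `A` NILPOTENT and COMMUTING with `b(λ)` (on paper: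
  `A = a ∈ NS(X) ⊂ H²`, even degree, so both hold in `H^{ev}(X)`; here they are the visible binders `hA`, `hc`):
  **`exp(-B)·exp(B̄) = exp((-2s)·b(λ))`** (`IsNilpotent.exp_add_of_commute`; the real part `A` drops out exactly as in §D);
* `pairing_top` — through any functional `deg` with `deg(b(λ)ᵏ) = 0` for `k < n` (on paper: `deg = ∫_X` vanishes below top
  degree — a visible binder `hdeg`): `deg(c·e^{-B} · c̄·e^{B̄}) = c·c̄·(-2s)ⁿ·(∏λ_a)·deg(vol)`;
* `neg_two_mul_pow_two_mul` — `s² = -d`, `n = 2m` ⇒ `(-2s)ⁿ = (-4d)^m`; `pairing_top_eq_chiSelfEven` — the LINK: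
  `2w·[(-2s)ⁿ·∏λ_a·deg(vol)] = chiSelfEven m d w (deg(b(λ)ⁿ))`, i.e. part 2's by-value `(v,v)_χ` IS this file's kernel value once
  `w = |x|²|c|²` and `deg = ∫_X`.
* §7 `lemmaProfile_euler` — the «`χ^G = -2`» input tied to the TREE's rank function: with th-6/th-7's
  `FormulaN.transversePairRank n k = r_k(n) = 2·C(n,k) - [k=0] - [k=n]` (FormulaNStatement.lean), for `n ≥ 1`
  `Σ_{k ≤ n} (-1)^k r_k(n) = P_n(-1) = -1 - (-1)^n` (`= -2` at even `n`, `= 0` at odd `n`) — the Euler characteristic of the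
  Lemma profile `e_k^G = r_k(n)`; that a `G`-semiregular secant object HAS this profile is th-7 §C (on paper).
* §8 THE BASIS MODEL (`W` with a basis `bW : Basis (Fin n ⊕ Fin n) K W`, frame `dx_a = bW(inl a)`, `dy_a = bW(inr a)`,
  `∫ := trace (twoVector bW) n` = the tree's normalised top trace of `Literature/…/HodgeStructureExteriorPowerLefschetzDual`,
  the same `∫` as s4-prove-1's SecantParity files): the by-value binders of §6 are DISCHARGED — `twoVector_eq_diagForm`
  (the tree's `ω_b` is `b(1)`), `diagForm_pow_mem` (`b(λ)ᵏ ∈ Λ^{2k}`), `trace_diagForm_pow_of_ne` (**`hdeg`**: `∫b(λ)ᵏ = 0`, `k ≠ n`),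
  `trace_vol` (**`hvol`**: `∫vol = 1`), `trace_diagForm_pow` (`∫b(λ)ⁿ = topCoeff λ = n!·∏λ_a`), `commute_diagForm_diagForm` +
  `isNilpotent_diagForm` (**`hA`, `hc`** for ANY `a = Σ_i μ_i du_i∧dv_i`, i.e. any element of `Λ²` written in any frame), and
  `trace_exp_neg_mul_exp` (`(ℓ,ℓ)_χ`-core: `∫(c e^{-B})(c e^{B}) = 0`, `n ≥ 1`) and
  **`trace_pairing`: `∫ (c·e^{-B})·(c̄·e^{B̄}) = c·c̄·(-2s)ⁿ·∏_a λ_a`** for `B = a + s·b(λ)`, `B̄ = a - s·b(λ)` — the exterior-algebra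
  content of th-7's `(ℓ,ℓ̄)_χ = |c|²(-2√-d)ⁿ∫bⁿ/n!` with NO by-value binder left.
WHAT STAYS ON PAPER (visible as hypotheses in §6, discharged in the basis model §8 where marked; never derived: HRR and the dual): HRR `χ(F,F') = ∫ch(F)^∨ch(F')` on an abelian variety (td = 1) and (H2)
`χ^G = χ/|G|`; the dual `ch(F)^∨ = c·e^{-B}` for `ch F = c·e^B` (sign `(-1)^i` on `H^{2i}`); `∫_X` kills degrees `< 2n` (`hdeg`);
`a` is even and nilpotent (`hA`, `hc`); `deg(vol) > 0` for the complex orientation; rationality `v = xℓ + x̄ℓ̄`.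

All statements and proofs: s4-prove-3 (2026-08-23).  Namespace `Summit.Ventures.HSemireg.Mod4Sign`.
-/

open Module

namespace Summit.Ventures.HSemireg.Mod4Sign

/-! ### §6 The pairing step of FORMULA-N §D in the model: `e^{-B} · e^{B̄} = e^{-2s·b}` and its top term -/

section PairingPrelim

variable (K : Type*) [CommRing K] {M : Type*} [AddCommGroup M] [Module K M] {n : ℕ}

/-- `vol` absorbs every `ω_a` on the left: `ω_a ∧ vol = 0`. -/
lemma omega_mul_vol (e f : Fin n → M) (a : Fin n) : omega K (e a) (f a) * vol K e f = 0 := by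
  rw [vol, List.ofFn_eq_map]
  exact mul_prod_map_eq_zero (fun a => omega K (e a) (f a)) (fun _ _ => commute_omega K _ _ _ _)
    (fun _ => omega_mul_self K _ _) (List.mem_finRange a)

/-- `b(λ) ∧ vol = 0`. -/
lemma diagForm_mul_vol (e f : Fin n → M) (lam : Fin n → K) : diagForm K e f lam * vol K e f = 0 := by
  rw [diagForm, Finset.sum_mul]
  exact Finset.sum_eq_zero fun a _ => by rw [smul_mul_assoc, omega_mul_vol, smul_zero]

/-- `b(λ)^{n+1} = 0` (so `b(λ)` is nilpotent of class `≤ n + 1`). -/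
theorem diagForm_pow_succ (e f : Fin n → M) (lam : Fin n → K) : diagForm K e f lam ^ (n + 1) = 0 := by
  rw [pow_succ', diagForm_pow, mul_smul_comm, diagForm_mul_vol, smul_zero]

/-- `b(λ)` is nilpotent. -/
theorem isNilpotent_diagForm (e f : Fin n → M) (lam : Fin n → K) : IsNilpotent (diagForm K e f lam) :=
  ⟨n + 1, diagForm_pow_succ K e f lam⟩

/-- THE EVEN-DIMENSIONAL SIGN FACTOR: with `s² = -d` (`s = √-d`) and `n = 2m`, `(-2s)ⁿ = (-4d)^m` — the factor of
`chiSelfEven` (part 2). -/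
theorem neg_two_mul_pow_two_mul {s d : K} (hs : s ^ 2 = -d) (m : ℕ) : (-2 * s) ^ (2 * m) = (-4 * d) ^ m := by
  rw [pow_mul, show (-2 * s : K) ^ 2 = -4 * d by linear_combination (4 : K) * hs]

end PairingPrelim

section Pairing

variable (K : Type*) [Field K] [CharZero K] {M : Type*} [AddCommGroup M] [Module K M]
  [Module ℚ M] [IsScalarTower ℚ K M] {n : ℕ}

/-- the `ℚ`-action on `Λ M` (through the tower `ℚ → K`, instances `[Module ℚ M] [IsScalarTower ℚ K M]` = restriction of
scalars, automatic for coordinate modules) is the `K`-action through the cast — this is the `ℚ`-module structure Mathlib's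
nilpotent exponential `IsNilpotent.exp` uses. -/
lemma rat_smul_eq (q : ℚ) (x : ExteriorAlgebra K M) : q • x = (q : K) • x := by
  rw [← algebraMap_smul K q x, eq_ratCast]

/-- THE EXPONENTIAL OF `t·b(λ)`: `exp(t b) = Σ_{k<n} (tᵏ/k!) bᵏ + (tⁿ·∏_a λ_a) · vol` — the top term is exact. -/
theorem exp_smul_diagForm (t : K) (e f : Fin n → M) (lam : Fin n → K) :
    IsNilpotent.exp (t • diagForm K e f lam) =
      ∑ k ∈ Finset.range n, ((k.factorial : K)⁻¹ * t ^ k) • diagForm K e f lam ^ k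
        + (t ^ n * ∏ a, lam a) • vol K e f := by
  have hpow : (t • diagForm K e f lam) ^ (n + 1) = 0 := by
    rw [smul_pow, diagForm_pow_succ, smul_zero]
  rw [IsNilpotent.exp_eq_sum hpow, Finset.sum_range_succ]
  congr 1
  · refine Finset.sum_congr rfl fun k _ => ?_
    rw [rat_smul_eq, smul_pow, smul_smul, Rat.cast_inv, Rat.cast_natCast]
  · rw [rat_smul_eq, smul_pow, diagForm_pow, smul_smul, smul_smul, Rat.cast_inv, Rat.cast_natCast]
    congr 1
    have h : (n.factorial : K) ≠ 0 := Nat.cast_ne_zero.mpr (Nat.factorial_ne_zero n)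
    field_simp

/-- THE PAIRING STEP (FORMULA-N-th7 §D: `ℓ^∨·ℓ̄ = c·e^{-B} · c̄·e^{B̄} = |c|²·e^{B̄-B}`, `B̄ - B = -2√-d·b`): for `B = A + s·b(λ)`,
`B̄ = A - s·b(λ)` with `A` nilpotent and commuting with `b(λ)` (on paper: `A = a ∈ NS(X)`, even degree), in `Λ M`:
`exp(-B) · exp(B̄) = exp((-2s)·b(λ))`. -/
theorem exp_neg_mul_exp_conj (A : ExteriorAlgebra K M) (hA : IsNilpotent A) (e f : Fin n → M) (lam : Fin n → K)
    (hc : Commute A (diagForm K e f lam)) (s : K) :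
    IsNilpotent.exp (-(A + s • diagForm K e f lam)) * IsNilpotent.exp (A - s • diagForm K e f lam) =
      IsNilpotent.exp ((-2 * s) • diagForm K e f lam) := by
  have hb := isNilpotent_diagForm K e f lam
  have h1 : IsNilpotent (-(A + s • diagForm K e f lam)) :=
    (Commute.isNilpotent_add (hc.smul_right s) hA (hb.smul s)).neg
  have h2 : IsNilpotent (A - s • diagForm K e f lam) := by
    rw [sub_eq_add_neg]
    exact Commute.isNilpotent_add (hc.smul_right s).neg_right hA (hb.smul s).neg
  have hcomm : Commute (-(A + s • diagForm K e f lam)) (A - s • diagForm K e f lam) := by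
    refine Commute.neg_left (Commute.add_left ?_ ?_)
    · exact Commute.sub_right (Commute.refl A) (hc.smul_right s)
    · exact Commute.sub_right (hc.smul_right s).symm ((Commute.refl _).smul_right s |>.smul_left s)
  rw [← IsNilpotent.exp_add_of_commute hcomm h1 h2]
  congr 1
  module

/-- … hence, through any functional `deg` that kills the lower powers `b(λ)ᵏ`, `k < n` (on paper: `deg = ∫_X` vanishes below
top degree), with `c, c̄` the scalar factors of `ℓ = c·e^B`:
`deg(c·e^{-B} · c̄·e^{B̄}) = c·c̄·(-2s)ⁿ·(∏_a λ_a)·deg(vol)` — th-7's `(ℓ,ℓ̄)_χ = |c|²(-2√-d)ⁿ∫bⁿ/n!` with `∫bⁿ = n!·∏λ_a·∫vol`. -/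
theorem pairing_top (deg : ExteriorAlgebra K M →ₗ[K] K) (e f : Fin n → M) (lam : Fin n → K)
    (hdeg : ∀ k < n, deg (diagForm K e f lam ^ k) = 0) (A : ExteriorAlgebra K M) (hA : IsNilpotent A)
    (hc : Commute A (diagForm K e f lam)) (s c cbar : K) :
    deg ((c • IsNilpotent.exp (-(A + s • diagForm K e f lam))) * (cbar • IsNilpotent.exp (A - s • diagForm K e f lam))) =
      c * cbar * ((-2 * s) ^ n * ∏ a, lam a) * deg (vol K e f) := by
  rw [smul_mul_smul_comm, exp_neg_mul_exp_conj K A hA e f lam hc s, exp_smul_diagForm, map_smul, map_add,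
    map_sum, map_smul, smul_eq_mul, smul_eq_mul]
  have h0 : ∑ k ∈ Finset.range n, deg (((k.factorial : K)⁻¹ * (-2 * s) ^ k) • diagForm K e f lam ^ k) = 0 :=
    Finset.sum_eq_zero fun k hk => by rw [map_smul, hdeg k (Finset.mem_range.mp hk), smul_zero]
  rw [h0, zero_add]
  ring

omit [Module ℚ M] [IsScalarTower ℚ K M] in
/-- LINK TO PART 2: at `n = 2m` with `s² = -d`, `2·w·[c c̄-free pairing core] = chiSelfEven m d w (deg(b(λ)ⁿ))`,
where `deg(b(λ)ⁿ) = topCoeff λ · deg(vol)` (`linearForm_diagForm_pow_eq`). -/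
theorem pairing_top_eq_chiSelfEven {m : ℕ} (deg : ExteriorAlgebra K M →ₗ[K] K) (e f : Fin (2 * m) → M)
    (lam : Fin (2 * m) → K) {s d : K} (hs : s ^ 2 = -d) (w : K) :
    2 * w * (((-2 * s) ^ (2 * m) * ∏ a, lam a) * deg (vol K e f)) =
      chiSelfEven m d w (deg (diagForm K e f lam ^ (2 * m))) := by
  rw [chiSelfEven, linearForm_diagForm_pow_eq, topCoeff, neg_two_mul_pow_two_mul K hs]
  have h : ((2 * m).factorial : K) ≠ 0 := Nat.cast_ne_zero.mpr (Nat.factorial_ne_zero _)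
  field_simp

end Pairing

/-! ### §7 The Lemma-profile Euler characteristic `P_n(-1) = -1 - (-1)^n` (the «χ^G = -2» input at even `n`) -/

section LemmaProfile

open Finset

/-- the tree's transverse-pair rank `r_k(n) = 2·C(n,k) - [k=0] - [k=n]` (FormulaNStatement, th-6/th-7) as an integer, for `n ≥ 1`
(no truncated subtraction). -/
theorem transversePairRank_cast {n : ℕ} (hn : 1 ≤ n) (k : ℕ) :
    (FormulaN.transversePairRank n k : ℤ) =
      2 * (n.choose k : ℤ) - (if k = 0 then 1 else 0) - (if k = n then 1 else 0) := by
  unfold FormulaN.transversePairRank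
  by_cases h0 : k = 0
  · subst h0
    have hn0 : (0 : ℕ) ≠ n := by omega
    simp [hn0]
  · by_cases hkn : k = n
    · subst hkn
      simp [h0]
    · simp [h0, hkn]

/-- THE LEMMA-PROFILE EULER CHARACTERISTIC: `Σ_k (-1)^k r_k(n) = P_n(-1) = -1 - (-1)^n` for `n ≥ 1`
(FORMULA-N-th7 §D: «the extremal profile has χ = Σ(-1)^k r_k = P_n(-1) = -1 - (-1)ⁿ»). -/
theorem lemmaProfile_euler {n : ℕ} (hn : 1 ≤ n) :
    ∑ k ∈ range (n + 1), (-1 : ℤ) ^ k * (FormulaN.transversePairRank n k : ℤ) = -1 - (-1) ^ n := by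
  simp_rw [transversePairRank_cast hn, mul_sub, Finset.sum_sub_distrib]
  have h1 : ∑ k ∈ range (n + 1), (-1 : ℤ) ^ k * (2 * (n.choose k : ℤ)) = 0 := by
    have := Int.alternating_sum_range_choose (n := n)
    rw [if_neg (by omega)] at this
    simp_rw [mul_left_comm ((-1 : ℤ) ^ _) 2, ← Finset.mul_sum, this, mul_zero]
  have h2 : ∑ k ∈ range (n + 1), (-1 : ℤ) ^ k * (if k = 0 then 1 else 0) = 1 := by
    rw [Finset.sum_eq_single 0]
    · simp
    · intro k _ hk; simp [hk]
    · intro h; simp at h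
  have h3 : ∑ k ∈ range (n + 1), (-1 : ℤ) ^ k * (if k = n then 1 else 0) = (-1) ^ n := by
    rw [Finset.sum_eq_single n]
    · simp
    · intro k _ hk; simp [hk]
    · intro h; simp at h
  rw [h1, h2, h3]
  ring

/-- … hence `χ^G = -2` for the Lemma profile at every EVEN `n ≥ 2` (and `0` at odd `n`): the value used in `signed_parity_law`. -/
theorem lemmaProfile_euler_even {n : ℕ} (hn : 1 ≤ n) (he : Even n) :
    ∑ k ∈ range (n + 1), (-1 : ℤ) ^ k * (FormulaN.transversePairRank n k : ℤ) = -2 := by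
  rw [lemmaProfile_euler hn, he.neg_one_pow]
  norm_num

/-- … and `0` at odd `n` (no `χ`-constraint: (S3) is vacuous at odd `n`). -/
theorem lemmaProfile_euler_odd {n : ℕ} (ho : Odd n) :
    ∑ k ∈ range (n + 1), (-1 : ℤ) ^ k * (FormulaN.transversePairRank n k : ℤ) = 0 := by
  rw [lemmaProfile_euler ho.pos, ho.neg_one_pow]
  norm_num

end LemmaProfile

/-! ### §8 The BASIS MODEL: `∫ := τ` the tree's normalised top trace — `hdeg` and `hvol` DISCHARGED, `∫vol = 1`, `∫bⁿ = n!·∏λ_a` -/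

section BasisPrelim

open Literature.AlgebraicGeometry.Motives.ExteriorLefschetz (twoVector pow_mem_exteriorPower)

variable (K : Type*) [CommRing K] {W : Type*} [AddCommGroup W] [Module K W] {n : ℕ}
  (bW : Module.Basis (Fin n ⊕ Fin n) K W)

/-- every `a = Σ_i μ_i du_i ∧ dv_i` (ANY finite family — every element of `Λ²` is of this form) commutes with `b(λ)`:
the binder `hc` of `exp_neg_mul_exp_conj` discharged structurally (even elements are central). -/
theorem commute_diagForm_diagForm {k : ℕ} {M : Type*} [AddCommGroup M] [Module K M] (u v : Fin k → M) (μ : Fin k → K)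
    (e f : Fin n → M) (lam : Fin n → K) : Commute (diagForm K u v μ) (diagForm K e f lam) :=
  Commute.sum_left _ _ _ fun i _ => Commute.sum_right _ _ _ fun a _ =>
    (((commute_omega K (u i) (v i) (e a) (f a)).smul_left (μ i)).smul_right (lam a))

/-- the tree's Darboux 2-vector `ω_b = Σ dz_j ∧ dz̄_j` IS `b(1)` in the basis frame. -/
theorem twoVector_eq_diagForm :
    twoVector bW = diagForm K (fun a => bW (Sum.inl a)) (fun a => bW (Sum.inr a)) (fun _ => (1 : K)) := by
  simp [twoVector, diagForm, omega]

/-- `b(λ) ∈ Λ² W`. -/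
theorem diagForm_mem_two {M : Type*} [AddCommGroup M] [Module K M] (e f : Fin n → M) (lam : Fin n → K) :
    diagForm K e f lam ∈ ⋀[K]^2 M := by
  refine Submodule.sum_mem _ fun a _ => Submodule.smul_mem _ _ ?_
  rw [ExteriorAlgebra.exteriorPower, pow_two]
  exact Submodule.mul_mem_mul (LinearMap.mem_range_self _ _) (LinearMap.mem_range_self _ _)

/-- `b(λ)ᵏ ∈ Λ^{2k}`. -/
theorem diagForm_pow_mem {M : Type*} [AddCommGroup M] [Module K M] (e f : Fin n → M) (lam : Fin n → K) (k : ℕ) :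
    diagForm K e f lam ^ k ∈ ⋀[K]^(2 * k) M :=
  pow_mem_exteriorPower (diagForm_mem_two K e f lam) k

end BasisPrelim

section BasisModel

open Literature.AlgebraicGeometry.Motives.ExteriorLefschetz (twoVector isSymplectic_twoVector trace trace_apply_of_mem_ne
  IsSymplectic.trace_pow)

variable (K : Type*) [Field K] [CharZero K] {W : Type*} [AddCommGroup W] [Module K W]
  [Module ℚ W] [IsScalarTower ℚ K W] {n : ℕ} (bW : Module.Basis (Fin n ⊕ Fin n) K W)

omit [Module ℚ W] [IsScalarTower ℚ K W] in
/-- DISCHARGE OF `hdeg`: the normalised top trace `τ = trace ω_b n` («∫_X», `∫ω_bⁿ = n!`) kills `b(λ)ᵏ` for `k ≠ n` (degree `2k ≠ 2n`). -/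
theorem trace_diagForm_pow_of_ne (lam : Fin n → K) {k : ℕ} (hk : k ≠ n) :
    trace (twoVector bW) n (diagForm K (fun a => bW (Sum.inl a)) (fun a => bW (Sum.inr a)) lam ^ k) = 0 :=
  trace_apply_of_mem_ne (diagForm_pow_mem K _ _ lam k) (by omega)

omit [Module ℚ W] [IsScalarTower ℚ K W] in
/-- DISCHARGE OF `hvol`: `∫ vol = 1` for the basis frame (from `ω_bⁿ = n!·vol`, part 1, and the tree's `τ(ω_bⁿ) = n!`). -/
theorem trace_vol : trace (twoVector bW) n (vol K (fun a => bW (Sum.inl a)) (fun a => bW (Sum.inr a))) = 1 := by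
  have h1 : twoVector bW ^ n = (n.factorial : K) • vol K (fun a => bW (Sum.inl a)) (fun a => bW (Sum.inr a)) := by
    rw [twoVector_eq_diagForm, diagForm_pow]
    simp
  have h2 := (isSymplectic_twoVector bW).trace_pow
  rw [h1, map_smul, smul_eq_mul] at h2
  have hn : (n.factorial : K) ≠ 0 := Nat.cast_ne_zero.mpr (Nat.factorial_ne_zero n)
  have : (n.factorial : K) * (trace (twoVector bW) n (vol K (fun a => bW (Sum.inl a)) (fun a => bW (Sum.inr a))) - 1) = 0 := by
    rw [mul_sub, h2, mul_one, sub_self]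
  rcases mul_eq_zero.mp this with h | h
  · exact absurd h hn
  · exact sub_eq_zero.mp h

omit [Module ℚ W] [IsScalarTower ℚ K W] in
/-- THE DEGREE IN THE BASIS MODEL: `∫ b(λ)ⁿ = n!·∏_a λ_a` (= `topCoeff λ`), no by-value binder left. -/
theorem trace_diagForm_pow (lam : Fin n → K) :
    trace (twoVector bW) n (diagForm K (fun a => bW (Sum.inl a)) (fun a => bW (Sum.inr a)) lam ^ n) = topCoeff lam := by
  rw [linearForm_diagForm_pow_eq, trace_vol, mul_one]

/-- THE PAIRING IN THE BASIS MODEL (FORMULA-N §D's `ℓ^∨·ℓ̄` integral, exterior-algebra part fully in kernel): for ANY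
`a = Σ_i μ_i du_i∧dv_i ∈ Λ²`, `B = a + s·b(λ)`, `B̄ = a - s·b(λ)`:
`∫ (c·e^{-B})·(c̄·e^{B̄}) = c·c̄·(-2s)ⁿ·∏_a λ_a` — the only inputs left on paper are HRR / the Mukai dual / `w = |x|²|c|²`. -/
theorem trace_pairing {k : ℕ} (u v : Fin k → W) (μ : Fin k → K) (lam : Fin n → K) (s c cbar : K) :
    trace (twoVector bW) n
      ((c • IsNilpotent.exp (-(diagForm K u v μ + s • diagForm K (fun a => bW (Sum.inl a)) (fun a => bW (Sum.inr a)) lam))) *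
        (cbar • IsNilpotent.exp (diagForm K u v μ - s • diagForm K (fun a => bW (Sum.inl a)) (fun a => bW (Sum.inr a)) lam))) =
      c * cbar * ((-2 * s) ^ n * ∏ a, lam a) := by
  rw [pairing_top K (trace (twoVector bW) n) _ _ lam (fun k hk => trace_diagForm_pow_of_ne K bW lam (ne_of_lt hk)) _
      (isNilpotent_diagForm K u v μ) (commute_diagForm_diagForm K u v μ _ _ lam) s c cbar, trace_vol, mul_one]

/-- … at `n = 2m` with `s² = -d` (`s = √-d`): `∫ (c·e^{-B})·(c̄·e^{B̄}) = c·c̄·(-4d)^m·∏_a λ_a` — with `c̄ c = |c|²`, `∫bⁿ = n!·∏λ_a`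
(`trace_diagForm_pow`) this is th-7's `(ℓ,ℓ̄)_χ = |c|²(-4d)^{n/2}∫bⁿ/n!` symbol for symbol, and `2|x|²·(ℓ,ℓ̄)_χ = chiSelfEven m d (|x|²|c|²) (∫bⁿ)`. -/
theorem trace_pairing_even {m k : ℕ} (bW : Module.Basis (Fin (2 * m) ⊕ Fin (2 * m)) K W) (u v : Fin k → W)
    (μ : Fin k → K) (lam : Fin (2 * m) → K) {s d : K} (hs : s ^ 2 = -d) (c cbar : K) :
    trace (twoVector bW) (2 * m)
      ((c • IsNilpotent.exp (-(diagForm K u v μ +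
          s • diagForm K (fun a => bW (Sum.inl a)) (fun a => bW (Sum.inr a)) lam))) *
        (cbar • IsNilpotent.exp (diagForm K u v μ -
          s • diagForm K (fun a => bW (Sum.inl a)) (fun a => bW (Sum.inr a)) lam))) =
      c * cbar * ((-4 * d) ^ m * ∏ a, lam a) := by
  rw [trace_pairing, neg_two_mul_pow_two_mul K hs]

/-- th-7 §D's first identity `(ℓ,ℓ)_χ = |c|²∫e^{-B}e^{B} = |c|²∫1 = 0` (`n ≥ 1`): in the basis model, for any nilpotent `B`. -/
theorem trace_exp_neg_mul_exp (hn : n ≠ 0) {B : ExteriorAlgebra K W} (hB : IsNilpotent B) (c : K) :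
    trace (twoVector bW) n ((c • IsNilpotent.exp (-B)) * (c • IsNilpotent.exp B)) = 0 := by
  rw [smul_mul_smul_comm, IsNilpotent.exp_neg_mul_exp_self hB, map_smul,
    trace_apply_of_mem_ne (m := 0) (SetLike.one_mem_graded _) (by omega), smul_zero]

end BasisModel

end Summit.Ventures.HSemireg.Mod4Sign
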